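import Mathlib
import HarnessLib
import Literature.Geometry.Riemannian.ChartMeasureComparison
import Summits.SmoothPoincare4.SmoothPoincare4.Theses.IsotropicCorkBracketing

/-!
# Route IsotropicCorkBracketing — support `SeamNull` (item stmt-SmoothPoincare4-11212)

The seam of a boundary gluing is a null set: if compact `4`-manifolds-with-boundary `C`, `W`
(boundaries presented as smooth `3`-manifolds `Z_C`, `Z_W` embedded by `ι_C`, `ι_W` onto the
boundaries) are embedded into a closed `4`-manifold `P` by `jC`, `jW` as a gluing along
`ψ : Z_C ≃ Z_W` (`jC a = jW b ↔ ∃ z, a = ι_C z ∧ b = ι_W (ψ z)`), then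
`range jC ∩ range jW` has Riemannian measure zero for every Riemannian metric on `P`.

Proof (Federer 1969, §2.10.11 and §3.2.46; Chavel 2006, §III.3): by the gluing clause the seam
is contained in the image of the `C¹` map `f = jC ∘ ι_C : Z_C³ → P⁴`.  Chart by chart the chart
expression of `f` is a `C¹` map `ℝ³ ⊇ t → ℝ⁴`, locally Lipschitz
(`ContDiffWithinAt.exists_lipschitzOnWith`), so its image is `μH[4]`-null because
`μH[4] = 0` on `ℝ³` (`Real.hausdorffMeasure_of_finrank_lt`) and Lipschitz maps expand `μH[4]` by
at most `K⁴` (`LipschitzOnWith.hausdorffMeasure_image_le`).  The Riemannian measure of `P` is the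
Euclidean-normalised Hausdorff measure of the length metric, and charts are locally bi-Lipschitz
for it (`Literature.Geometry.Riemannian.exists_isOpen_biLipschitz_extChartAt`,
`vol_le_and_le_of_biLipschitz`), so the image of a small neighbourhood of every point of `Z_C` is
null in `P`; `Z_C` is second countable (it embeds into `C`), so countably many such
neighbourhoods cover it.
-/

noncomputable section

open Set Function Filter Manifold MeasureTheory Measure Module Topology
open scoped Manifold ContDiff Topology ENNReal NNReal

set_option linter.dupNamespace false

namespace Summit.SmoothPoincare4.SmoothPoincare4.Theorems

open Literature.Geometry.Lorentzian Literature.Geometry.Riemannian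

/-- **`C¹` images of lower-dimensional manifolds are null for the Riemannian measure**
(Federer 1969, §2.10.11, §3.2.46): if `Z` is a second countable space charted on `ℝᵐ`, `P` a
smooth manifold modelled on `ℝᵏ` with `m < k` carrying a Riemannian `PseudoRiemannianMetric` `G`,
and `f : Z → P` is `C¹`, then `Vol_G (f '' s) = 0` for every `s ⊆ Z`.  Chart by chart: the chart
expression of `f` is locally Lipschitz, `μH[k] = 0` on `ℝᵐ`, and the charts of `P` are locally
bi-Lipschitz for the Riemannian distance. -/
theorem riemVolume_image_eq_zero_of_contMDiff {m k : ℕ} (hmk : m < k)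
    {Z : Type*} [TopologicalSpace Z] [ChartedSpace (EuclideanSpace ℝ (Fin m)) Z]
    [SecondCountableTopology Z]
    {P : Type*} [TopologicalSpace P] [ChartedSpace (EuclideanSpace ℝ (Fin k)) P]
    [IsManifold (𝓡 k) ∞ P] [T3Space P] [MeasurableSpace P] [BorelSpace P]
    (G : PseudoRiemannianMetric (𝓡 k) ∞ (EuclideanSpace ℝ (Fin k)) (TangentSpace (𝓡 k) : P → Type _))
    (hG : G.IsRiemannian) {f : Z → P} (hf : ContMDiff (𝓡 m) (𝓡 k) 1 f) (s : Set Z) :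
    G.riemVolume (f '' s) = 0 := by
  -- the relevant Hausdorff measure vanishes identically on the source model space `ℝᵐ`
  have hzero_m : (μH[(finrank ℝ (EuclideanSpace ℝ (Fin k)) : ℝ)] :
      Measure (EuclideanSpace ℝ (Fin m))) = 0 := by
    apply Real.hausdorffMeasure_of_finrank_lt
    simp only [finrank_euclideanSpace, Fintype.card_fin]
    exact_mod_cast hmk
  -- local statement: every point of `Z` has a neighbourhood with null image
  have hloc : ∀ z : Z, ∃ V ∈ 𝓝 z, G.vol (f '' V) = 0 := by
    intro z
    obtain ⟨U, hUo, hxU, hUs, C, -, hup, hlow, -⟩ :=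
      exists_isOpen_biLipschitz_extChartAt G hG (f z)
    obtain ⟨-, hdiff⟩ := contMDiffAt_iff.1 (hf z)
    obtain ⟨K, t, ht, hK⟩ := hdiff.exists_lipschitzOnWith (𝓡 m).convex_range
    set χ := extChartAt (𝓡 m) z with hχ
    set φ := extChartAt (𝓡 k) (f z) with hφ
    set V : Set Z := χ.source ∩ χ ⁻¹' t ∩ f ⁻¹' U with hV
    refine ⟨V, ?_, ?_⟩
    · refine inter_mem (inter_mem (extChartAt_source_mem_nhds z) ?_)
        (hf.continuous.continuousAt.preimage_mem_nhds (hUo.mem_nhds hxU))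
      exact extChartAt_preimage_mem_nhds_of_mem_nhdsWithin (mem_extChartAt_source z) ht
    · have hVU : f '' V ⊆ U := by
        rintro _ ⟨v, hv, rfl⟩
        exact hv.2
      have h1 := (vol_le_and_le_of_biLipschitz G hG (f z) hUs hup hlow hVU).1
      -- the chart image of `f '' V` is contained in the image of `χ '' V ⊆ t` under the
      -- (Lipschitz) chart expression of `f`
      have hsub : φ '' (f '' V) ⊆ (φ ∘ f ∘ χ.symm) '' (χ '' V) := by
        rintro _ ⟨_, ⟨v, hv, rfl⟩, rfl⟩
        exact ⟨χ v, mem_image_of_mem _ hv, by simp [χ.left_inv hv.1.1]⟩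
      have hsub' : χ '' V ⊆ t := by
        rintro _ ⟨v, hv, rfl⟩
        exact hv.1.2
      have hzero_k : (μH[(finrank ℝ (EuclideanSpace ℝ (Fin k)) : ℝ)] :
          Measure (EuclideanSpace ℝ (Fin k))) (φ '' (f '' V)) = 0 := by
        refine measure_mono_null hsub (le_antisymm ?_ zero_le)
        calc (μH[(finrank ℝ (EuclideanSpace ℝ (Fin k)) : ℝ)] : Measure (EuclideanSpace ℝ (Fin k)))
              ((φ ∘ f ∘ χ.symm) '' (χ '' V))
            ≤ (K : ℝ≥0∞) ^ (finrank ℝ (EuclideanSpace ℝ (Fin k)) : ℝ) *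
                (μH[(finrank ℝ (EuclideanSpace ℝ (Fin k)) : ℝ)] : Measure (EuclideanSpace ℝ (Fin m)))
                  (χ '' V) :=
              (hK.mono hsub').hausdorffMeasure_image_le (Nat.cast_nonneg _)
          _ = 0 := by rw [hzero_m, Measure.coe_zero, Pi.zero_apply, mul_zero]
      have hzeroE : (μHE[finrank ℝ (EuclideanSpace ℝ (Fin k))] : Measure (EuclideanSpace ℝ (Fin k)))
          (φ '' (f '' V)) = 0 := by
        rw [Measure.euclideanHausdorffMeasure_def, Measure.smul_apply, hzero_k, smul_zero]
      refine le_antisymm ?_ zero_le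
      calc G.vol (f '' V) ≤ _ := h1
        _ = 0 := by rw [hzeroE, mul_zero]
  choose V hV hV0 using hloc
  obtain ⟨T, hTc, hTU⟩ := TopologicalSpace.countable_cover_nhds hV
  have hcov : f '' s ⊆ ⋃ z ∈ T, f '' V z := by
    rintro _ ⟨w, -, rfl⟩
    have hw : w ∈ ⋃ z ∈ T, V z := by
      rw [hTU]
      exact mem_univ w
    obtain ⟨z, hz, hwz⟩ := mem_iUnion₂.1 hw
    exact mem_iUnion₂.2 ⟨z, hz, mem_image_of_mem f hwz⟩
  exact measure_mono_null hcov ((measure_biUnion_null_iff hTc).2 fun z _ ↦ hV0 z)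

/-- **SeamNull** (route IsotropicCorkBracketing, item stmt-SmoothPoincare4-11212): the seam
`range jC ∩ range jW` of a boundary gluing `P = C ∪_ψ W` of compact smooth `4`-manifolds with
boundary has Riemannian measure zero for every Riemannian metric `G` on `P`.  By the gluing clause
the seam lies in the image of the `C¹` map `jC ∘ ι_C` of the `3`-manifold `Z_C`, which is null by
`riemVolume_image_eq_zero_of_contMDiff` (Federer 1969, §2.10.11, §3.2.46). -/
theorem seamNull_proof :
    Summit.SmoothPoincare4.SmoothPoincare4.Theses.IsotropicCorkBracketing.SeamNull := by
  unfold Theses.IsotropicCorkBracketing.SeamNull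
  intro C _ _ _ _ _ _ ZC _ _ _ ιC hιC _ W _ _ _ _ _ _ ZW _ _ _ ιW _ _ ψ P _ _ _ _ _ _ _ _ jC jW
    hjC _ _ hglue G hG
  -- the seam is contained in the image of `Z_C` under `jC ∘ ι_C`
  have hseam : range jC ∩ range jW ⊆ (jC ∘ ιC) '' univ := by
    rintro x ⟨⟨a, rfl⟩, ⟨b, hb⟩⟩
    obtain ⟨z, rfl, -⟩ := (hglue a b).1 hb.symm
    exact ⟨z, mem_univ z, rfl⟩
  haveI : SecondCountableTopology ZC := hιC.isEmbedding.secondCountableTopology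
  have hf : ContMDiff (𝓡 3) (𝓡 4) 1 (jC ∘ ιC) :=
    (hjC.contMDiff.comp hιC.contMDiff).of_le ENat.LEInfty.out
  rw [← PseudoRiemannianMetric.riemVolume_eq hG]
  exact measure_mono_null hseam
    (riemVolume_image_eq_zero_of_contMDiff (by norm_num) G hG hf univ)

end Summit.SmoothPoincare4.SmoothPoincare4.Theorems

end
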